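import Summits.CriticalPhenomena.PercolationContinuityZ3.Theorems.PercNearOneGluingNoHeavyLowerTailApexTwoSum
import HarnessLib

/-!
# `NoHeavyLowerTail` (stmt-CriticalPhenomena-4575) — 2-sums through the apex, part 7:
# discharging the side conditions — the FKG slack for `q ≥ 1` and non-degeneracy from a positive support

Support file (prover prim-gen-kcluster gen 72; `--supports stmt-CriticalPhenomena-4575`).  No definitions, no named
facts, no sorries.  Vocabulary as in part 5 (`…ApexTwoSum`), instance `(a; t, h)` of the free random-cluster measure
`φ = rcMeasureW u q ∅` with arm cells `A = {t, h ∈ C(a)}`, `B = {t ∉ C(a), h ∈ C(a)}`, `C = {t ∈ C(a), h ∉ C(a)}`,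
`D = {t, h ∉ C(a), h ∈ C(t)}`, `E = {a, t, h pairwise apart}`.

* `ApexTwoSum.fkg_slack_of_one_le` — for `q ≥ 1`: `φ(B)(φ(C) + φ(D)) ≤ φ(A) φ(E)`.  This is positive association
  (`rcMeasureW_fkg`, Grimmett Thm. (3.8)) for the increasing events `{h ∈ C(a)} = A ⊔ B` and `{t ∈ C(a) ∨ t ∈ C(h)} = A ⊔ C ⊔ D`,
  whose intersection is `A`: `A ≥ (A + B)(A + C + D)` with `A + B + C + D + E = 1`.
* `ApexTwoSum.real_pos_of_support` — if `u > 0` on `D₀` and `u = 0` off `D₀`, every event containing the configuration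
  `D₀` itself has positive `φ`-mass (the all-open configuration has weight `∏_{D₀} u_e · q^k > 0`); with
  `ApexTwoSum.mem_cl_coe_of_mem` (a support pair joins its endpoints in the all-open configuration) this discharges the
  non-degeneracy hypotheses of `r1_of_apexTwoSum` for connected arms.
* `ApexTwoSum.r1_of_apexTwoSum_of_one_le` — the 2-sum theorem for `q ≥ 1` with the FKG slacks discharged.
-/

noncomputable section

namespace Summit.CriticalPhenomena.PercolationContinuityZ3.Theorems

namespace ApexTwoSum

open Finset SimpleGraph Literature.Probability.Percolation Literature.Probability.Percolation.Gladkov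
open Literature.Probability.Percolation.BHK2006 (weight)
open Literature.Probability.Percolation.DecisionTree (ind ind_of_mem ind_of_not_mem ind_nonneg)
open Literature.Probability.LatticeModels RefinedRowR3 ThreePointLB MeasureTheory
open scoped Classical

variable {V : Type*} [Fintype V]

/-! ### Monotonicity of clusters in the configuration -/

/-- Clusters grow with the configuration. [folklore] -/
theorem cl_toFinset_mono {η η' : BondConfig V} (hle : η ⊆ η') (x : V) : cl η.toFinset x ⊆ cl η'.toFinset x :=
  cl_mono (fun e he => by rw [Set.mem_toFinset] at he ⊢; exact hle he) x

/-- `{h ∈ C(a)}` is increasing. [folklore] -/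
theorem isUpperSet_mem_cl (a h : V) : IsUpperSet {η : BondConfig V | h ∈ cl η.toFinset a} :=
  fun _ _ hle hη => cl_toFinset_mono hle a hη

/-- `{t ∈ C(a) ∨ h ∈ C(t)}` is increasing. [folklore] -/
theorem isUpperSet_mem_cl_or (a h t : V) :
    IsUpperSet {η : BondConfig V | t ∈ cl η.toFinset a ∨ h ∈ cl η.toFinset t} :=
  fun _ _ hle hη => hη.imp (fun h1 => cl_toFinset_mono hle a h1) (fun h1 => cl_toFinset_mono hle t h1)

/-! ### The FKG slack for `q ≥ 1` -/

section FKG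

variable {a h t : V} (u : Sym2 V → unitInterval) {q : ℝ} (hq : 1 ≤ q)
include hq

/-- **The FKG slack of an arm, `q ≥ 1`**: `φ(B)(φ(C) + φ(D)) ≤ φ(A) φ(E)` for the cells of the instance `(a; t, h)`. [this work] -/
theorem fkg_slack_of_one_le :
    (rcMeasureW u q ∅).real {η : BondConfig V | t ∉ cl η.toFinset a ∧ h ∈ cl η.toFinset a} *
        ((rcMeasureW u q ∅).real {η : BondConfig V | t ∈ cl η.toFinset a ∧ h ∉ cl η.toFinset a} +
          (rcMeasureW u q ∅).real {η : BondConfig V | t ∉ cl η.toFinset a ∧ h ∉ cl η.toFinset a ∧ h ∈ cl η.toFinset t}) ≤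
      (rcMeasureW u q ∅).real {η : BondConfig V | t ∈ cl η.toFinset a ∧ h ∈ cl η.toFinset a} *
        (rcMeasureW u q ∅).real {η : BondConfig V | t ∉ cl η.toFinset a ∧ h ∉ cl η.toFinset a ∧ h ∉ cl η.toFinset t} := by
  have hq0 : 0 < q := one_pos.trans_le hq
  have hZ := rcPartitionFunctionW_pos u hq0 (∅ : Set V)
  have fkg := rcMeasureW_fkg u hq ∅ (isUpperSet_mem_cl a h) (isUpperSet_mem_cl_or a h t)
  -- pointwise splitting of the indicators
  have e1 : ∀ η : BondConfig V, ind {η : BondConfig V | h ∈ cl η.toFinset a} η =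
      ind {η : BondConfig V | t ∈ cl η.toFinset a ∧ h ∈ cl η.toFinset a} η +
        ind {η : BondConfig V | t ∉ cl η.toFinset a ∧ h ∈ cl η.toFinset a} η := by
    intro η
    by_cases ht : t ∈ cl η.toFinset a <;> by_cases hh : h ∈ cl η.toFinset a
    · rw [ind_of_mem (show η ∈ {η : BondConfig V | h ∈ cl η.toFinset a} from hh),
        ind_of_mem (show η ∈ {η : BondConfig V | t ∈ cl η.toFinset a ∧ h ∈ cl η.toFinset a} from ⟨ht, hh⟩),
        ind_of_not_mem (fun hη : η ∈ {η : BondConfig V | t ∉ cl η.toFinset a ∧ h ∈ cl η.toFinset a} => hη.1 ht)]; ring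
    · rw [ind_of_not_mem (show η ∉ {η : BondConfig V | h ∈ cl η.toFinset a} from hh),
        ind_of_not_mem (fun hη : η ∈ {η : BondConfig V | t ∈ cl η.toFinset a ∧ h ∈ cl η.toFinset a} => hh hη.2),
        ind_of_not_mem (fun hη : η ∈ {η : BondConfig V | t ∉ cl η.toFinset a ∧ h ∈ cl η.toFinset a} => hh hη.2)]; ring
    · rw [ind_of_mem (show η ∈ {η : BondConfig V | h ∈ cl η.toFinset a} from hh),
        ind_of_not_mem (fun hη : η ∈ {η : BondConfig V | t ∈ cl η.toFinset a ∧ h ∈ cl η.toFinset a} => ht hη.1),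
        ind_of_mem (show η ∈ {η : BondConfig V | t ∉ cl η.toFinset a ∧ h ∈ cl η.toFinset a} from ⟨ht, hh⟩)]; ring
    · rw [ind_of_not_mem (show η ∉ {η : BondConfig V | h ∈ cl η.toFinset a} from hh),
        ind_of_not_mem (fun hη : η ∈ {η : BondConfig V | t ∈ cl η.toFinset a ∧ h ∈ cl η.toFinset a} => hh hη.2),
        ind_of_not_mem (fun hη : η ∈ {η : BondConfig V | t ∉ cl η.toFinset a ∧ h ∈ cl η.toFinset a} => hh hη.2)]; ring
  have e2 : ∀ η : BondConfig V, ind {η : BondConfig V | t ∈ cl η.toFinset a ∨ h ∈ cl η.toFinset t} η =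
      ind {η : BondConfig V | t ∈ cl η.toFinset a ∧ h ∈ cl η.toFinset a} η +
        ind {η : BondConfig V | t ∈ cl η.toFinset a ∧ h ∉ cl η.toFinset a} η +
        ind {η : BondConfig V | t ∉ cl η.toFinset a ∧ h ∉ cl η.toFinset a ∧ h ∈ cl η.toFinset t} η := by
    intro η
    by_cases ht : t ∈ cl η.toFinset a <;> by_cases hh : h ∈ cl η.toFinset a
    · rw [ind_of_mem (show η ∈ {η : BondConfig V | t ∈ cl η.toFinset a ∨ h ∈ cl η.toFinset t} from Or.inl ht),
        ind_of_mem (show η ∈ {η : BondConfig V | t ∈ cl η.toFinset a ∧ h ∈ cl η.toFinset a} from ⟨ht, hh⟩),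
        ind_of_not_mem (fun hη : η ∈ {η : BondConfig V | t ∈ cl η.toFinset a ∧ h ∉ cl η.toFinset a} => hη.2 hh),
        ind_of_not_mem (fun hη : η ∈ {η : BondConfig V | t ∉ cl η.toFinset a ∧ h ∉ cl η.toFinset a ∧ h ∈ cl η.toFinset t} => hη.1 ht)]
      ring
    · rw [ind_of_mem (show η ∈ {η : BondConfig V | t ∈ cl η.toFinset a ∨ h ∈ cl η.toFinset t} from Or.inl ht),
        ind_of_not_mem (fun hη : η ∈ {η : BondConfig V | t ∈ cl η.toFinset a ∧ h ∈ cl η.toFinset a} => hh hη.2),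
        ind_of_mem (show η ∈ {η : BondConfig V | t ∈ cl η.toFinset a ∧ h ∉ cl η.toFinset a} from ⟨ht, hh⟩),
        ind_of_not_mem (fun hη : η ∈ {η : BondConfig V | t ∉ cl η.toFinset a ∧ h ∉ cl η.toFinset a ∧ h ∈ cl η.toFinset t} => hη.1 ht)]
      ring
    · -- `h ∈ C(a)`, `t ∉ C(a)`: then `h ∉ C(t)`
      have hht : h ∉ cl η.toFinset t := fun h1 => ht (mem_cl_trans hh (mem_cl_comm.1 h1))
      rw [ind_of_not_mem (show η ∉ {η : BondConfig V | t ∈ cl η.toFinset a ∨ h ∈ cl η.toFinset t} from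
          fun hη => hη.elim ht hht),
        ind_of_not_mem (fun hη : η ∈ {η : BondConfig V | t ∈ cl η.toFinset a ∧ h ∈ cl η.toFinset a} => ht hη.1),
        ind_of_not_mem (fun hη : η ∈ {η : BondConfig V | t ∈ cl η.toFinset a ∧ h ∉ cl η.toFinset a} => ht hη.1),
        ind_of_not_mem (fun hη : η ∈ {η : BondConfig V | t ∉ cl η.toFinset a ∧ h ∉ cl η.toFinset a ∧ h ∈ cl η.toFinset t} => hη.2.1 hh)]
      ring
    · by_cases hd : h ∈ cl η.toFinset t
      · rw [ind_of_mem (show η ∈ {η : BondConfig V | t ∈ cl η.toFinset a ∨ h ∈ cl η.toFinset t} from Or.inr hd),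
          ind_of_not_mem (fun hη : η ∈ {η : BondConfig V | t ∈ cl η.toFinset a ∧ h ∈ cl η.toFinset a} => ht hη.1),
          ind_of_not_mem (fun hη : η ∈ {η : BondConfig V | t ∈ cl η.toFinset a ∧ h ∉ cl η.toFinset a} => ht hη.1),
          ind_of_mem (show η ∈ {η : BondConfig V | t ∉ cl η.toFinset a ∧ h ∉ cl η.toFinset a ∧ h ∈ cl η.toFinset t} from ⟨ht, hh, hd⟩)]
        ring
      · rw [ind_of_not_mem (show η ∉ {η : BondConfig V | t ∈ cl η.toFinset a ∨ h ∈ cl η.toFinset t} from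
            fun hη => hη.elim ht hd),
          ind_of_not_mem (fun hη : η ∈ {η : BondConfig V | t ∈ cl η.toFinset a ∧ h ∈ cl η.toFinset a} => ht hη.1),
          ind_of_not_mem (fun hη : η ∈ {η : BondConfig V | t ∈ cl η.toFinset a ∧ h ∉ cl η.toFinset a} => ht hη.1),
          ind_of_not_mem (fun hη : η ∈ {η : BondConfig V | t ∉ cl η.toFinset a ∧ h ∉ cl η.toFinset a ∧ h ∈ cl η.toFinset t} => hd hη.2.2)]
        ring
  have e3 : ∀ η : BondConfig V, ind ({η : BondConfig V | h ∈ cl η.toFinset a} ∩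
      {η : BondConfig V | t ∈ cl η.toFinset a ∨ h ∈ cl η.toFinset t}) η =
      ind {η : BondConfig V | t ∈ cl η.toFinset a ∧ h ∈ cl η.toFinset a} η := by
    intro η
    by_cases hA : η ∈ {η : BondConfig V | t ∈ cl η.toFinset a ∧ h ∈ cl η.toFinset a}
    · rw [ind_of_mem hA, ind_of_mem (show η ∈ _ ∩ _ from ⟨hA.2, Or.inl hA.1⟩)]
    · rw [ind_of_not_mem hA, ind_of_not_mem]
      rintro ⟨hh, ht | hd⟩
      · exact hA ⟨ht, hh⟩
      · exact hA ⟨mem_cl_trans hh (mem_cl_comm.1 hd), hh⟩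
  have e4 : ∀ η : BondConfig V, (1 : ℝ) =
      ind {η : BondConfig V | t ∈ cl η.toFinset a ∧ h ∈ cl η.toFinset a} η +
        ind {η : BondConfig V | t ∉ cl η.toFinset a ∧ h ∈ cl η.toFinset a} η +
        ind {η : BondConfig V | t ∈ cl η.toFinset a ∧ h ∉ cl η.toFinset a} η +
        ind {η : BondConfig V | t ∉ cl η.toFinset a ∧ h ∉ cl η.toFinset a ∧ h ∈ cl η.toFinset t} η +
        ind {η : BondConfig V | t ∉ cl η.toFinset a ∧ h ∉ cl η.toFinset a ∧ h ∉ cl η.toFinset t} η := by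
    intro η
    by_cases ht : t ∈ cl η.toFinset a <;> by_cases hh : h ∈ cl η.toFinset a
    · rw [ind_of_mem (show η ∈ {η : BondConfig V | t ∈ cl η.toFinset a ∧ h ∈ cl η.toFinset a} from ⟨ht, hh⟩),
        ind_of_not_mem (fun hη : η ∈ {η : BondConfig V | t ∉ cl η.toFinset a ∧ h ∈ cl η.toFinset a} => hη.1 ht),
        ind_of_not_mem (fun hη : η ∈ {η : BondConfig V | t ∈ cl η.toFinset a ∧ h ∉ cl η.toFinset a} => hη.2 hh),
        ind_of_not_mem (fun hη : η ∈ {η : BondConfig V | t ∉ cl η.toFinset a ∧ h ∉ cl η.toFinset a ∧ h ∈ cl η.toFinset t} => hη.1 ht),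
        ind_of_not_mem (fun hη : η ∈ {η : BondConfig V | t ∉ cl η.toFinset a ∧ h ∉ cl η.toFinset a ∧ h ∉ cl η.toFinset t} => hη.1 ht)]
      ring
    · rw [ind_of_not_mem (fun hη : η ∈ {η : BondConfig V | t ∈ cl η.toFinset a ∧ h ∈ cl η.toFinset a} => hh hη.2),
        ind_of_not_mem (fun hη : η ∈ {η : BondConfig V | t ∉ cl η.toFinset a ∧ h ∈ cl η.toFinset a} => hη.1 ht),
        ind_of_mem (show η ∈ {η : BondConfig V | t ∈ cl η.toFinset a ∧ h ∉ cl η.toFinset a} from ⟨ht, hh⟩),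
        ind_of_not_mem (fun hη : η ∈ {η : BondConfig V | t ∉ cl η.toFinset a ∧ h ∉ cl η.toFinset a ∧ h ∈ cl η.toFinset t} => hη.1 ht),
        ind_of_not_mem (fun hη : η ∈ {η : BondConfig V | t ∉ cl η.toFinset a ∧ h ∉ cl η.toFinset a ∧ h ∉ cl η.toFinset t} => hη.1 ht)]
      ring
    · rw [ind_of_not_mem (fun hη : η ∈ {η : BondConfig V | t ∈ cl η.toFinset a ∧ h ∈ cl η.toFinset a} => ht hη.1),
        ind_of_mem (show η ∈ {η : BondConfig V | t ∉ cl η.toFinset a ∧ h ∈ cl η.toFinset a} from ⟨ht, hh⟩),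
        ind_of_not_mem (fun hη : η ∈ {η : BondConfig V | t ∈ cl η.toFinset a ∧ h ∉ cl η.toFinset a} => ht hη.1),
        ind_of_not_mem (fun hη : η ∈ {η : BondConfig V | t ∉ cl η.toFinset a ∧ h ∉ cl η.toFinset a ∧ h ∈ cl η.toFinset t} => hη.2.1 hh),
        ind_of_not_mem (fun hη : η ∈ {η : BondConfig V | t ∉ cl η.toFinset a ∧ h ∉ cl η.toFinset a ∧ h ∉ cl η.toFinset t} => hη.2.1 hh)]
      ring
    · by_cases hd : h ∈ cl η.toFinset t
      · rw [ind_of_not_mem (fun hη : η ∈ {η : BondConfig V | t ∈ cl η.toFinset a ∧ h ∈ cl η.toFinset a} => ht hη.1),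
          ind_of_not_mem (fun hη : η ∈ {η : BondConfig V | t ∉ cl η.toFinset a ∧ h ∈ cl η.toFinset a} => hh hη.2),
          ind_of_not_mem (fun hη : η ∈ {η : BondConfig V | t ∈ cl η.toFinset a ∧ h ∉ cl η.toFinset a} => ht hη.1),
          ind_of_mem (show η ∈ {η : BondConfig V | t ∉ cl η.toFinset a ∧ h ∉ cl η.toFinset a ∧ h ∈ cl η.toFinset t} from ⟨ht, hh, hd⟩),
          ind_of_not_mem (fun hη : η ∈ {η : BondConfig V | t ∉ cl η.toFinset a ∧ h ∉ cl η.toFinset a ∧ h ∉ cl η.toFinset t} => hη.2.2 hd)]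
        ring
      · rw [ind_of_not_mem (fun hη : η ∈ {η : BondConfig V | t ∈ cl η.toFinset a ∧ h ∈ cl η.toFinset a} => ht hη.1),
          ind_of_not_mem (fun hη : η ∈ {η : BondConfig V | t ∉ cl η.toFinset a ∧ h ∈ cl η.toFinset a} => hh hη.2),
          ind_of_not_mem (fun hη : η ∈ {η : BondConfig V | t ∈ cl η.toFinset a ∧ h ∉ cl η.toFinset a} => ht hη.1),
          ind_of_not_mem (fun hη : η ∈ {η : BondConfig V | t ∉ cl η.toFinset a ∧ h ∉ cl η.toFinset a ∧ h ∈ cl η.toFinset t} => hd hη.2.2),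
          ind_of_mem (show η ∈ {η : BondConfig V | t ∉ cl η.toFinset a ∧ h ∉ cl η.toFinset a ∧ h ∉ cl η.toFinset t} from ⟨ht, hh, hd⟩)]
        ring
  -- the masses as sums
  simp only [rcMeasureW_real_eq_sum_div u hq0] at fkg ⊢
  set Z := rcPartitionFunctionW u q ∅ with hZdef
  set A := ∑ η : BondConfig V, rcWeightW u q ∅ η * ind {η : BondConfig V | t ∈ cl η.toFinset a ∧ h ∈ cl η.toFinset a} η with hA
  set B := ∑ η : BondConfig V, rcWeightW u q ∅ η * ind {η : BondConfig V | t ∉ cl η.toFinset a ∧ h ∈ cl η.toFinset a} η with hB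
  set C := ∑ η : BondConfig V, rcWeightW u q ∅ η * ind {η : BondConfig V | t ∈ cl η.toFinset a ∧ h ∉ cl η.toFinset a} η with hC
  set D := ∑ η : BondConfig V, rcWeightW u q ∅ η * ind {η : BondConfig V | t ∉ cl η.toFinset a ∧ h ∉ cl η.toFinset a ∧ h ∈ cl η.toFinset t} η with hD
  set E := ∑ η : BondConfig V, rcWeightW u q ∅ η * ind {η : BondConfig V | t ∉ cl η.toFinset a ∧ h ∉ cl η.toFinset a ∧ h ∉ cl η.toFinset t} η with hE
  have s1 : ∑ η : BondConfig V, rcWeightW u q ∅ η * ind {η : BondConfig V | h ∈ cl η.toFinset a} η = A + B := by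
    rw [hA, hB, ← Finset.sum_add_distrib]
    exact Finset.sum_congr rfl fun η _ => by rw [e1 η]; ring
  have s2 : ∑ η : BondConfig V, rcWeightW u q ∅ η * ind {η : BondConfig V | t ∈ cl η.toFinset a ∨ h ∈ cl η.toFinset t} η =
      A + C + D := by
    rw [hA, hC, hD, ← Finset.sum_add_distrib, ← Finset.sum_add_distrib]
    exact Finset.sum_congr rfl fun η _ => by rw [e2 η]; ring
  have s3 : ∑ η : BondConfig V, rcWeightW u q ∅ η * ind ({η : BondConfig V | h ∈ cl η.toFinset a} ∩
      {η : BondConfig V | t ∈ cl η.toFinset a ∨ h ∈ cl η.toFinset t}) η = A := by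
    rw [hA]
    exact Finset.sum_congr rfl fun η _ => by rw [e3 η]
  have htot : Z = A + B + C + D + E := by
    rw [hZdef, hA, hB, hC, hD, hE]
    unfold rcPartitionFunctionW
    rw [← Finset.sum_add_distrib, ← Finset.sum_add_distrib, ← Finset.sum_add_distrib, ← Finset.sum_add_distrib]
    refine Finset.sum_congr rfl fun η _ => ?_
    have h4 := e4 η
    linear_combination (rcWeightW u q ∅ η) * h4
  rw [s1, s2, s3] at fkg
  -- clear denominators
  rw [div_mul_div_comm, div_le_div_iff₀ (mul_pos hZ hZ) hZ] at fkg
  have fkg' : (A + B) * (A + C + D) ≤ A * Z := by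
    refine le_of_mul_le_mul_right ?_ hZ
    calc (A + B) * (A + C + D) * Z ≤ A * (Z * Z) := fkg
      _ = A * Z * Z := by ring
  rw [← add_div, div_mul_div_comm, div_mul_div_comm, div_le_div_iff_of_pos_right (mul_pos hZ hZ)]
  have key : A * E - B * (C + D) = A * Z - (A + B) * (A + C + D) := by rw [htot]; ring
  linarith [fkg', key]

end FKG

/-! ### Non-degeneracy from a positive support -/

section Positivity

variable (u : Sym2 V → unitInterval) {q : ℝ} (hq : 0 < q) (D₀ : Finset (Sym2 V))

include hq in
/-- **Positive mass of events containing the all-open configuration.**  If `u > 0` on `D₀` and `u = 0` off `D₀`, then every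
event containing the configuration `D₀` has positive `φ`-mass. [this work] -/
theorem real_pos_of_support (hpos : ∀ e ∈ D₀, 0 < (u e : ℝ)) (hoff : ∀ e ∉ (↑D₀ : Set (Sym2 V)), (u e : ℝ) = 0)
    {E : Set (BondConfig V)} (hE : (↑D₀ : Set (Sym2 V)) ∈ E) : 0 < (rcMeasureW u q ∅).real E := by
  rw [rcMeasureW_real_eq_sum_div u hq]
  refine div_pos ?_ (rcPartitionFunctionW_pos u hq ∅)
  have hterm : 0 < rcWeightW u q ∅ (↑D₀ : Set (Sym2 V)) * ind E (↑D₀ : Set (Sym2 V)) := by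
    rw [ind_of_mem hE, mul_one]
    unfold rcWeightW
    refine mul_pos ?_ (pow_pos hq _)
    unfold weight
    refine Finset.prod_pos fun e _ => ?_
    by_cases he : e ∈ (↑D₀ : Set (Sym2 V))
    · rw [if_pos he]; exact hpos e (Finset.mem_coe.1 he)
    · rw [if_neg he]
      show 0 < 1 - (u e : ℝ)
      rw [hoff e he]; norm_num
  exact lt_of_lt_of_le hterm (Finset.single_le_sum (f := fun η : BondConfig V => rcWeightW u q ∅ η * ind E η)
    (fun η _ => mul_nonneg (rcWeightW_nonneg u hq.le _ η) (ind_nonneg E η)) (Finset.mem_univ _))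

/-- The root is in its own cluster of the all-open configuration (event form). [folklore] -/
theorem cl_coe_self (x : V) : (↑D₀ : BondConfig V) ∈ {η : BondConfig V | x ∈ cl η.toFinset x} := by
  simp only [Set.mem_setOf_eq]; exact mem_cl_self _ _

/-- One support pair extends a cluster of the all-open configuration (event form). [folklore] -/
theorem cl_coe_step {x y z : V} (hy : (↑D₀ : BondConfig V) ∈ {η : BondConfig V | y ∈ cl η.toFinset x})
    (hyz : s(y, z) ∈ D₀) (hne : y ≠ z) : (↑D₀ : BondConfig V) ∈ {η : BondConfig V | z ∈ cl η.toFinset x} := by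
  simp only [Set.mem_setOf_eq] at hy ⊢
  refine mem_cl_of_adj hy (adj_iff.2 ⟨?_, hne⟩)
  simp only [Set.mem_toFinset]; exact hyz

end Positivity


/-! ### The 2-sum theorem for `q ≥ 1` (FKG slacks discharged) -/

section OneLe

variable {DX DY D : Finset (Sym2 V)} {a h b c : V} (hah : a ≠ h) (hab : a ≠ b) (hac : a ≠ c) (hbc : b ≠ c)
  (hhb : h ≠ b) (hhc : h ≠ c)
  (hsepD : ∀ v : V, (∃ e ∈ DX, v ∈ e) → (∃ e ∈ DY, v ∈ e) → (v = a ∨ v = h))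
  (hbY : ∀ e ∈ DY, b ∉ e) (hcX : ∀ e ∈ DX, c ∉ e) (hD : ∀ e, e ∈ D ↔ e ∈ DX ∨ e ∈ DY)
  (w wX wY : Sym2 V → unitInterval) {q : ℝ} (hq : 1 ≤ q)
  (hw : ∀ e, e ∉ (↑DX ∪ ↑DY : Set (Sym2 V)) → (w e : ℝ) = 0)
  (hX : ∀ e ∈ (↑DX : Set (Sym2 V)), wX e = w e) (hX' : ∀ e ∉ (↑DX : Set (Sym2 V)), wX e = 0)
  (hY : ∀ e ∈ (↑DX : Set (Sym2 V)), wY e = 0) (hY' : ∀ e ∉ (↑DX : Set (Sym2 V)), wY e = w e)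
include hah hab hac hbc hhb hhc hsepD hbY hcX hD hq hw hX hX' hY hY'

/-- **The apex 2-sum theorem for `q ≥ 1`**: R1 on both arms (instances `(a; b, h)`, `(a; c, h)`) and non-degeneracy imply R1 for `(a; b, c)`
on the glued graph; the FKG slacks of `r1_of_apexTwoSum` hold automatically (`fkg_slack_of_one_le`). [this work] -/
theorem r1_of_apexTwoSum_of_one_le
    (hR1X : (rcMeasureW wX q ∅).real {η : BondConfig V | b ∈ cl η.toFinset a ∧ h ∈ cl η.toFinset a} * (rcMeasureW wX q ∅).real {η : BondConfig V | b ∉ cl η.toFinset a ∧ h ∉ cl η.toFinset a ∧ Sep DX (cl η.toFinset a) b h} ≤ (rcMeasureW wX q ∅).real {η : BondConfig V | b ∈ cl η.toFinset a ∧ h ∉ cl η.toFinset a} * (rcMeasureW wX q ∅).real {η : BondConfig V | b ∉ cl η.toFinset a ∧ h ∈ cl η.toFinset a}) (hAX : (rcMeasureW wX q ∅).real {η : BondConfig V | b ∈ cl η.toFinset a ∧ h ∈ cl η.toFinset a} ≠ 0)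
    (hR1Y : (rcMeasureW wY q ∅).real {η : BondConfig V | c ∈ cl η.toFinset a ∧ h ∈ cl η.toFinset a} * (rcMeasureW wY q ∅).real {η : BondConfig V | c ∉ cl η.toFinset a ∧ h ∉ cl η.toFinset a ∧ Sep DY (cl η.toFinset a) c h} ≤ (rcMeasureW wY q ∅).real {η : BondConfig V | c ∈ cl η.toFinset a ∧ h ∉ cl η.toFinset a} * (rcMeasureW wY q ∅).real {η : BondConfig V | c ∉ cl η.toFinset a ∧ h ∈ cl η.toFinset a}) (hAY : (rcMeasureW wY q ∅).real {η : BondConfig V | c ∈ cl η.toFinset a ∧ h ∈ cl η.toFinset a} ≠ 0) :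
    (rcMeasureW w q ∅).real {η : BondConfig V | b ∈ cl η.toFinset a ∧ c ∈ cl η.toFinset a} * (rcMeasureW w q ∅).real {η : BondConfig V | b ∉ cl η.toFinset a ∧ c ∉ cl η.toFinset a ∧ Sep D (cl η.toFinset a) b c} ≤ (rcMeasureW w q ∅).real {η : BondConfig V | b ∈ cl η.toFinset a ∧ c ∉ cl η.toFinset a} * (rcMeasureW w q ∅).real {η : BondConfig V | b ∉ cl η.toFinset a ∧ c ∈ cl η.toFinset a} :=
  r1_of_apexTwoSum hah hab hac hbc hhb hhc hsepD hbY hcX hD w wX wY (one_pos.trans_le hq) hw hX hX' hY hY'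
    hR1X (fkg_slack_of_one_le (a := a) (h := h) (t := b) wX hq) hAX
    hR1Y (fkg_slack_of_one_le (a := a) (h := h) (t := c) wY hq) hAY

end OneLe


end ApexTwoSum

end Summit.CriticalPhenomena.PercolationContinuityZ3.Theorems
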